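import Summits.AtomisticToContinuum.FouriersLaw.Theorems.HiddenChargeMazurOddChargeExistsStubOverlapDensityLimit

/-!
# `OddChargeExists` / Negative (1): shift-coboundary charges have `O(1)` current overlap

Support file (`--supports stmt-AtomisticToContinuum-13511`) of the NEGATIVE side of the crux
`HiddenChargeMazur.OddChargeExists` (stmt-AtomisticToContinuum-13511; line `registered` =
`Cruxes/OddChargeExists/Lines/birth.lean`, lead prover).  The crux asks for an odd polynomial window density `g` of
the pinned anharmonic chain with EXTENSIVE static current overlap `c·N ≤ |∫ J_N Q_N dGibbs_{N,T}|`.  This file proves,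
unconditionally, the analytic half of why a TRIVIAL conservation law can never be such a witness:

* `potential_eq_sum` — if `g = h∘succ − h∘castSucc + c` on a window of `k+1` cells then the potential `h` is
  DETERMINED by `g` up to the constant `h 0`: `h u = h 0 + Σ_{m<k} (g(0^{m+1}, u_0, …, u_{k-2-m}) − c)` (telescoping
  along zero-padding); in particular `h` inherits continuity and polynomial growth from `g`;
* `coboundary_overlap_bounded` — for `pinnedChain ω₂ lam β γ` (all parameters `> 0`), `T > 0`, every `R` and
  every ODD POLYNOMIAL window density `g` on `2R+1` cells that is a shift-coboundary (+ constant), the overlap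
  `∫ J_N · Q_N d(volume.tilted (−H_N/T))` (verbatim the crux's expression) is BOUNDED uniformly in `N ≥ 2R+2`:
  `Q_N` telescopes to `h(right window) − h(left window)` (the constant is `g(0) = 0` by oddness), and by momentum
  orthogonality + `N`-uniform site moments (`OverlapDensityLimit.pinnedChain_current_obs_term`) only the `≤ 2R+2`
  bonds touching each boundary window correlate with it, each by at most `C₁`.

Consequence (next file): the crux implies the existence of an odd polynomial local conservation law that is NOT a
shift-coboundary — the content of the registered stub `stub_oddConservationLaw` — so the classification
"every odd polynomial local conservation law of the pinned chain is a shift-coboundary" refutes the crux.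
No definitions, no named facts, no `sorry`; all `[folklore]`.
-/

noncomputable section

open MeasureTheory Set Function Finset Filter Topology
open scoped BigOperators

namespace Summit.AtomisticToContinuum.FouriersLaw.Theorems.OddChargeExists.Negative

open Literature.MathematicalPhysics.KineticTheory.HeatConduction OscillatorChain
open Summit.AtomisticToContinuum.FouriersLaw.Theorems.OddChargeExists.OverlapDensityLimit

/-! ### §1 The potential of a shift-coboundary is determined by the density -/

section Algebra

variable {α : Type*} [Zero α] {k : ℕ} {g : (Fin (k + 1) → α) → ℝ} {h : (Fin k → α) → ℝ} {c : ℝ}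

/-- **Telescoping along zero-padding.** If `g(y) = h(y∘succ) − h(y∘castSucc) + c` for all windows `y` of `k+1`
cells, then `h u = h 0 + Σ_{m<k} (g(0^{m+1} ⧺ u) − c)` where `0^{m+1} ⧺ u` is the window whose first `m+1` cells
are `0` followed by `u_0, u_1, …` (truncated). [folklore] -/
theorem potential_eq_sum (hcob : ∀ y, g y = h (fun i => y i.succ) - h (fun i => y i.castSucc) + c)
    (u : Fin k → α) :
    h u = h (fun _ => 0) + ∑ m ∈ Finset.range k,
      (g (fun i : Fin (k + 1) => if hi : i.val ≤ m then 0 else u ⟨i.val - m - 1, by omega⟩) - c) := by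
  -- the zero-padded shifts `T^m u = (0^m, u_0, …, u_{k-1-m})`
  obtain ⟨Tm, hTm⟩ : ∃ Tm : ℕ → (Fin k → α), ∀ m i, Tm m i = if i.val < m then 0 else u ⟨i.val - m, by omega⟩ :=
    ⟨fun m i => if i.val < m then 0 else u ⟨i.val - m, by omega⟩, fun _ _ => rfl⟩
  have hstep : ∀ m : ℕ, g (fun i : Fin (k + 1) => if hi : i.val ≤ m then 0 else u ⟨i.val - m - 1, by omega⟩) - c =
      h (Tm m) - h (Tm (m + 1)) := by
    intro m
    rw [hcob]
    have e1 : (fun i : Fin k => (fun i : Fin (k + 1) => if hi : i.val ≤ m then (0 : α) else u ⟨i.val - m - 1, by omega⟩)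
        i.succ) = Tm m := by
      funext i
      rw [hTm]
      simp only [Fin.val_succ]
      by_cases hi : i.val < m
      · rw [dif_pos (by omega), if_pos hi]
      · rw [dif_neg (by omega), if_neg hi]
        congr 1
        exact Fin.ext (by simp only; omega)
    have e2 : (fun i : Fin k => (fun i : Fin (k + 1) => if hi : i.val ≤ m then (0 : α) else u ⟨i.val - m - 1, by omega⟩)
        i.castSucc) = Tm (m + 1) := by
      funext i
      rw [hTm]
      simp only [Fin.val_castSucc]
      by_cases hi : i.val < m + 1
      · rw [dif_pos (by omega), if_pos hi]
      · rw [dif_neg (by omega), if_neg hi]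
        congr 1
    rw [e1, e2]
    ring
  have hT0 : Tm 0 = u := by
    funext i
    rw [hTm, if_neg (Nat.not_lt_zero _)]
    congr 1
  have hTk : Tm k = fun _ => 0 := by
    funext i
    rw [hTm, if_pos i.isLt]
  rw [Finset.sum_congr rfl fun m _ => hstep m, Finset.sum_range_sub', hT0, hTk]
  ring

/-- The constant of an ODD shift-coboundary vanishes (evaluate at the zero window), for cells in a type with a
momentum flip fixing `0`. [folklore] -/
theorem const_eq_zero_of_odd {g : (Fin (k + 1) → ℝ × ℝ) → ℝ} {h : (Fin k → ℝ × ℝ) → ℝ} {c : ℝ}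
    (hcob : ∀ y, g y = h (fun i => y i.succ) - h (fun i => y i.castSucc) + c)
    (hodd : ∀ y : Fin (k + 1) → ℝ × ℝ, g (fun i => ((y i).1, -(y i).2)) = -g y) : c = 0 := by
  have h0 := hodd fun _ => (0, 0)
  simp only [neg_zero] at h0
  have hg0 : g (fun _ => ((0 : ℝ), (0 : ℝ))) = 0 := by linarith
  have h1 := hcob fun _ => (0, 0)
  linarith

end Algebra

/-! ### §2 Window potentials read on the finite chain -/

section Pinned

variable {ω₂ lam β : ℝ}

/-- **Coboundary charges have bounded current overlap.** For `pinnedChain ω₂ lam β γ` (all parameters `> 0`),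
`T > 0`, a window radius `R` and an odd polynomial density `g` on `2R+1` cells which is a shift-coboundary plus a
constant (`g(y) = h(y∘succ) − h(y∘castSucc) + c` for some function `h` of `2R` cells and `c : ℝ`), the static
current overlap of its bulk charge — verbatim the crux's `∫ J_N · Q_N d(volume.tilted (−H_N/T))` — is bounded
uniformly in `N ≥ 2R+2`.  Proof: `c = g(0) = 0` by oddness; `Q_N = h(cells N−2R..N−1) − h(cells 0..2R−1)`
telescopes; `h` is `h(0)` plus a sum of `2R` values of `g` at zero-padded windows (`potential_eq_sum`), hence a
continuous, polynomially bounded, momentum-local observable; by `pinnedChain_current_obs_term` only the `≤ 2R+2`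
bonds touching a boundary window correlate with it, each by at most the `N`-uniform constant `C₁`. [folklore] -/
theorem coboundary_overlap_bounded (hω : 0 < ω₂) (hl : 0 < lam) (hβ : 0 < β) (γ : ℝ) {T : ℝ} (hT : 0 < T)
    (R : ℕ) {g : (Fin (2 * R + 1) → ℝ × ℝ) → ℝ}
    (hg : ∃ p : MvPolynomial (Fin (2 * R + 1) ⊕ Fin (2 * R + 1)) ℝ, ∀ y : Fin (2 * R + 1) → ℝ × ℝ,
      g y = MvPolynomial.eval (Sum.elim (fun i => (y i).1) (fun i => (y i).2)) p)
    (hodd : ∀ y : Fin (2 * R + 1) → ℝ × ℝ, g (fun i => ((y i).1, -(y i).2)) = -g y)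
    (hcob : ∃ (h : (Fin (2 * R) → ℝ × ℝ) → ℝ) (c : ℝ), ∀ y : Fin (2 * R + 1) → ℝ × ℝ,
      g y = h (fun i : Fin (2 * R) => y i.succ) - h (fun i : Fin (2 * R) => y i.castSucc) + c) :
    ∃ C : ℝ, ∀ N : ℕ, 2 * R + 2 ≤ N →
      |∫ z, (∑ i : Fin N, (pinnedChain ω₂ lam β γ).bondCurrent N i z) *
          (∑ x ∈ Finset.range (N - 2 * R), g (fun i => if h : x + i.val < N then (z.1 ⟨x + i.val, h⟩, z.2 ⟨x + i.val, h⟩)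
            else (0, 0)))
        ∂((volume : Measure (PhaseSpace N)).tilted fun x => -(pinnedChain ω₂ lam β γ).hamiltonian N x / T)| ≤ C := by
  obtain ⟨h, c, hcob⟩ := hcob
  have hc0 : c = 0 := const_eq_zero_of_odd hcob hodd
  subst hc0
  obtain ⟨Cg, hCg, dg, hgb⟩ := growth_of_poly hg
  have hgc : Continuous g := continuous_of_poly hg
  -- the constant of the potential observable
  set Ch : ℝ := |h fun _ => 0| + (2 * R : ℕ) * Cg with hCh
  have hCh0 : 0 ≤ Ch := by positivity
  obtain ⟨C₁, hC₁0, hC₁⟩ := pinnedChain_current_obs_term hω hl hβ γ hT R hCh0 dg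
  refine ⟨2 * (((2 * R + 2 : ℕ) : ℝ) * C₁), fun N hN => ?_⟩
  -- cells of the `N`-chain read through the crux's padding convention
  obtain ⟨cell, hcell⟩ : ∃ cell : PhaseSpace N → ℕ → ℝ × ℝ,
      ∀ z n, cell z n = if hn : n < N then (z.1 ⟨n, hn⟩, z.2 ⟨n, hn⟩) else (0, 0) := ⟨_, fun _ _ => rfl⟩
  -- the window potential anchored at `a`
  obtain ⟨hw, hhw⟩ : ∃ hw : ℕ → PhaseSpace N → ℝ, ∀ a z, hw a z = h fun i : Fin (2 * R) => cell z (a + i.val) :=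
    ⟨_, fun _ _ => rfl⟩
  -- (1) telescoping of the bulk charge
  have htel : ∀ z : PhaseSpace N,
      (∑ x ∈ Finset.range (N - 2 * R), g (fun i => if h : x + i.val < N then (z.1 ⟨x + i.val, h⟩, z.2 ⟨x + i.val, h⟩)
        else (0, 0))) = hw (N - 2 * R) z - hw 0 z := by
    intro z
    have hterm : ∀ x : ℕ, g (fun i : Fin (2 * R + 1) => if h : x + i.val < N then (z.1 ⟨x + i.val, h⟩, z.2 ⟨x + i.val, h⟩)
        else (0, 0)) = hw (x + 1) z - hw x z := by
      intro x
      rw [hcob, add_zero, hhw, hhw]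
      congr 2
      · funext i
        rw [hcell]
        have e : x + (i.val + 1) = x + 1 + i.val := by ring
        simp only [Fin.val_succ, e]
      · funext i
        rw [hcell]
        simp only [Fin.val_castSucc]
    simp_rw [hterm]
    exact Finset.sum_range_sub (fun x => hw x z) (N - 2 * R)
  -- (2) the window potential as an explicit observable: `h 0 + Σ_m g(zero-padded window)`
  have hwexp : ∀ (a : ℕ) (z : PhaseSpace N), hw a z = h (fun _ => 0) + ∑ m ∈ Finset.range (2 * R),
      (g (fun i : Fin (2 * R + 1) => if hi : i.val ≤ m then 0 else cell z (a + (i.val - m - 1))) - 0) := by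
    intro a z
    rw [hhw, potential_eq_sum hcob]
  -- (3) facts on the window potentials anchored at `a`, seen through the `(2R+1)`-window at `x ≤ a`, `a ≤ x + 1`
  have hfacts : ∀ (a x : ℕ) (hxN : x + 2 * R < N) (hxa : x ≤ a) (hax : a ≤ x + 1) (i : Fin N),
      Integrable (fun z : PhaseSpace N => (pinnedChain ω₂ lam β γ).bondCurrent N i z * hw a z)
        ((pinnedChain ω₂ lam β γ).gibbsMeasure N T) ∧
      |∫ z, (pinnedChain ω₂ lam β γ).bondCurrent N i z * hw a z ∂((pinnedChain ω₂ lam β γ).gibbsMeasure N T)| ≤ C₁ ∧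
      ((i.val + 1 < x ∨ x + 2 * R < i.val) →
        ∫ z, (pinnedChain ω₂ lam β γ).bondCurrent N i z * hw a z ∂((pinnedChain ω₂ lam β γ).gibbsMeasure N T) = 0) := by
    intro a x hxN hxa hax i
    set sg : Fin (2 * R + 1) → Fin N := fun t => ⟨x + t.val, by omega⟩ with hsg
    refine hC₁ N i x sg (hw a) ?_ ?_ ?_
    · -- continuity
      rw [show hw a = fun z => h (fun _ => 0) + ∑ m ∈ Finset.range (2 * R),
          (g (fun i : Fin (2 * R + 1) => if hi : i.val ≤ m then 0 else cell z (a + (i.val - m - 1))) - 0)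
        from funext (hwexp a)]
      refine continuous_const.add (continuous_finsetSum _ fun m _ => ?_)
      refine (hgc.comp (continuous_pi fun j => ?_)).sub continuous_const
      by_cases hj : j.val ≤ m
      · simp only [dif_pos hj]
        exact continuous_const
      · simp only [dif_neg hj, hcell]
        split_ifs
        · fun_prop
        · exact continuous_const
    · -- polynomial domination by the site sum of the `(2R+1)`-window at `x`
      intro z
      set B : ℝ := 1 + ∑ t : Fin (2 * R + 1), (z.1 (sg t) ^ 2 + z.2 (sg t) ^ 2) with hB
      have hB1 : 1 ≤ B := one_le_siteSum sg z
      have hcellB : ∀ n : ℕ, a ≤ n → n < a + 2 * R → |(cell z n).1| ≤ B ∧ |(cell z n).2| ≤ B := by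
        intro n hn1 hn2
        have hnN : n < N := by omega
        have ht : n - x < 2 * R + 1 := by omega
        have hsgt : sg ⟨n - x, ht⟩ = ⟨n, hnN⟩ := Fin.ext (by simp only [hsg]; omega)
        have h1 := abs_fst_le_siteSum sg z ⟨n - x, ht⟩
        have h2 := abs_snd_le_siteSum sg z ⟨n - x, ht⟩
        rw [hsgt] at h1 h2
        rw [hcell, dif_pos hnN]
        exact ⟨h1, h2⟩
      have hgm : ∀ m ∈ Finset.range (2 * R),
          |g (fun i : Fin (2 * R + 1) => if hi : i.val ≤ m then 0 else cell z (a + (i.val - m - 1))) - 0| ≤ Cg * B ^ dg := by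
        intro m hm
        rw [Finset.mem_range] at hm
        rw [sub_zero]
        refine hgb _ B hB1 (fun j => ?_) (fun j => ?_)
        · by_cases hj : j.val ≤ m
          · simp only [dif_pos hj, Prod.fst_zero, abs_zero]; positivity
          · simp only [dif_neg hj]
            exact (hcellB _ (by omega) (by omega)).1
        · by_cases hj : j.val ≤ m
          · simp only [dif_pos hj, Prod.snd_zero, abs_zero]; positivity
          · simp only [dif_neg hj]
            exact (hcellB _ (by omega) (by omega)).2
      rw [hwexp a z]
      have hBd : 1 ≤ B ^ dg := one_le_pow₀ hB1
      calc |h (fun _ => 0) + ∑ m ∈ Finset.range (2 * R),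
              (g (fun i : Fin (2 * R + 1) => if hi : i.val ≤ m then 0 else cell z (a + (i.val - m - 1))) - 0)|
          ≤ |h fun _ => 0| + ∑ m ∈ Finset.range (2 * R),
              |g (fun i : Fin (2 * R + 1) => if hi : i.val ≤ m then 0 else cell z (a + (i.val - m - 1))) - 0| :=
            (abs_add_le _ _).trans (add_le_add le_rfl (Finset.abs_sum_le_sum_abs _ _))
        _ ≤ |h fun _ => 0| + ∑ m ∈ Finset.range (2 * R), Cg * B ^ dg := by
            gcongr with m hm
            exact hgm m hm
        _ = |h fun _ => 0| + (2 * R : ℕ) * (Cg * B ^ dg) := by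
            rw [Finset.sum_const, Finset.card_range, nsmul_eq_mul]
        _ ≤ |h fun _ => 0| * B ^ dg + (2 * R : ℕ) * (Cg * B ^ dg) := by
            gcongr
            exact le_mul_of_one_le_right (abs_nonneg _) hBd
        _ = Ch * B ^ dg := by rw [hCh]; ring
    · -- blindness to the momenta outside `[x, x + 2R]`
      intro l hl z t
      rw [hhw, hhw]
      congr 1
      funext j
      rw [hcell, hcell]
      by_cases hn : a + j.val < N
      · rw [dif_pos hn, dif_pos hn]
        have hne : (⟨a + j.val, hn⟩ : Fin N) ≠ l := by
          intro e
          have := congrArg Fin.val e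
          simp only at this
          omega
        simp only [Function.update_of_ne hne]
      · rw [dif_neg hn, dif_neg hn]
  -- (4) at most `2R+2` bonds touch a window; each term is bounded by `C₁`
  have hbd : ∀ (a x : ℕ) (hxN : x + 2 * R < N) (hxa : x ≤ a) (hax : a ≤ x + 1),
      |∑ i : Fin N, ∫ z, (pinnedChain ω₂ lam β γ).bondCurrent N i z * hw a z ∂((pinnedChain ω₂ lam β γ).gibbsMeasure N T)| ≤
        ((2 * R + 2 : ℕ) : ℝ) * C₁ := by
    intro a x hxN hxa hax
    have hle : ∀ i : Fin N, |∫ z, (pinnedChain ω₂ lam β γ).bondCurrent N i z * hw a z ∂((pinnedChain ω₂ lam β γ).gibbsMeasure N T)| ≤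
        if x ≤ i.val + 1 ∧ i.val ≤ x + 2 * R then C₁ else 0 := by
      intro i
      split_ifs with ht
      · exact (hfacts a x hxN hxa hax i).2.1
      · rw [(hfacts a x hxN hxa hax i).2.2 (by omega), abs_zero]
    have hcard : (((Finset.univ : Finset (Fin N)).filter (fun i : Fin N => x ≤ i.val + 1 ∧ i.val ≤ x + 2 * R)).card : ℝ) ≤
        ((2 * R + 2 : ℕ) : ℝ) := by
      have h1 : ((Finset.univ : Finset (Fin N)).filter (fun i : Fin N => x ≤ i.val + 1 ∧ i.val ≤ x + 2 * R)).card ≤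
          (Finset.Icc (x - 1) (x + 2 * R)).card := by
        refine Finset.card_le_card_of_injOn (fun i => i.val) (fun i hi => ?_) (fun i _ i' _ h => Fin.ext h)
        simp only [Finset.coe_filter, Finset.mem_univ, true_and, Set.mem_setOf_eq] at hi
        simp only [Finset.coe_Icc, Set.mem_Icc]
        omega
      rw [Nat.card_Icc] at h1
      have h2 : x + 2 * R + 1 - (x - 1) ≤ 2 * R + 2 := by omega
      exact_mod_cast h1.trans h2
    calc |∑ i : Fin N, ∫ z, (pinnedChain ω₂ lam β γ).bondCurrent N i z * hw a z ∂((pinnedChain ω₂ lam β γ).gibbsMeasure N T)|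
        ≤ ∑ i : Fin N, |∫ z, (pinnedChain ω₂ lam β γ).bondCurrent N i z * hw a z ∂((pinnedChain ω₂ lam β γ).gibbsMeasure N T)| :=
          Finset.abs_sum_le_sum_abs _ _
      _ ≤ ∑ i : Fin N, (if x ≤ i.val + 1 ∧ i.val ≤ x + 2 * R then C₁ else 0) := Finset.sum_le_sum fun i _ => hle i
      _ = (((Finset.univ : Finset (Fin N)).filter (fun i : Fin N => x ≤ i.val + 1 ∧ i.val ≤ x + 2 * R)).card : ℝ) * C₁ := by
          rw [Finset.sum_ite, Finset.sum_const_zero, add_zero, Finset.sum_const, nsmul_eq_mul]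
      _ ≤ ((2 * R + 2 : ℕ) : ℝ) * C₁ := mul_le_mul_of_nonneg_right hcard hC₁0
  -- (5) assemble
  have hIR := fun i => (hfacts (N - 2 * R) (N - 2 * R - 1) (by omega) (by omega) (by omega) i).1
  have hIL := fun i => (hfacts 0 0 (by omega) le_rfl (by omega) i).1
  rw [← OscillatorChain.gibbsMeasure_eq]
  have e1 : ∀ z : PhaseSpace N, (∑ i : Fin N, (pinnedChain ω₂ lam β γ).bondCurrent N i z) *
      (∑ x ∈ Finset.range (N - 2 * R), g (fun i => if h : x + i.val < N then (z.1 ⟨x + i.val, h⟩, z.2 ⟨x + i.val, h⟩)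
        else (0, 0))) =
      (∑ i : Fin N, (pinnedChain ω₂ lam β γ).bondCurrent N i z * hw (N - 2 * R) z) -
        ∑ i : Fin N, (pinnedChain ω₂ lam β γ).bondCurrent N i z * hw 0 z := by
    intro z
    rw [htel z, Finset.sum_mul, ← Finset.sum_sub_distrib]
    refine Finset.sum_congr rfl fun i _ => ?_
    ring
  rw [integral_congr_ae (Eventually.of_forall e1), integral_sub (integrable_finsetSum _ fun i _ => hIR i)
    (integrable_finsetSum _ fun i _ => hIL i), integral_finsetSum _ (fun i _ => hIR i),
    integral_finsetSum _ (fun i _ => hIL i)]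
  have hbR := hbd (N - 2 * R) (N - 2 * R - 1) (by omega) (by omega) (by omega)
  have hbL := hbd 0 0 (by omega) le_rfl (by omega)
  calc |(∑ i : Fin N, ∫ z, (pinnedChain ω₂ lam β γ).bondCurrent N i z * hw (N - 2 * R) z ∂((pinnedChain ω₂ lam β γ).gibbsMeasure N T)) -
        ∑ i : Fin N, ∫ z, (pinnedChain ω₂ lam β γ).bondCurrent N i z * hw 0 z ∂((pinnedChain ω₂ lam β γ).gibbsMeasure N T)|
      ≤ |∑ i : Fin N, ∫ z, (pinnedChain ω₂ lam β γ).bondCurrent N i z * hw (N - 2 * R) z ∂((pinnedChain ω₂ lam β γ).gibbsMeasure N T)| +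
        |∑ i : Fin N, ∫ z, (pinnedChain ω₂ lam β γ).bondCurrent N i z * hw 0 z ∂((pinnedChain ω₂ lam β γ).gibbsMeasure N T)| :=
        abs_sub _ _
    _ ≤ ((2 * R + 2 : ℕ) : ℝ) * C₁ + ((2 * R + 2 : ℕ) : ℝ) * C₁ := add_le_add hbR hbL
    _ = 2 * (((2 * R + 2 : ℕ) : ℝ) * C₁) := by ring

end Pinned

end Summit.AtomisticToContinuum.FouriersLaw.Theorems.OddChargeExists.Negative

end
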